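/-
Copyright (c) 2026 the pub-hodgecm-mathlib formalisation cell (harness21).  Prover seat hodgecm-mathlib-K2E1-p13 (g3), Track B ∕ K2-LIT, h413 = `stmt-HodgeConjecture-24833`,
line `K2_E1_TraceFormulaBeta`, route of record `HCCMUnconditional`; dealer K2E1-plan (g7) (265) AMENDMENT #3 C.3 («hconj at level K_f(𝔫)»), census item (N4): the TWO-FUNCTION
reflection principle for PERMUTED MATRIX ENTRIES of the scattering operator — the level-𝔫 edition of ★ `K2E1ChiScatteringConjSymmetryCMTwo` §1–§2 (this lineage, g2).
-/
import Summits.HodgeConjecture.HodgeConjecture.Theorems.K2E1ChiScatteringConjSymmetryCMTwo   -- ★ p860146 (this lineage, g2): the one-function edition; brings ★ `differentiableOn_conj_comp_conj`, ★ `countable_of_codiscrete`, ★ `isPreconnected_convex_diff_of_countable`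
import HarnessLib

/-!
# K2·E1 — `K2E1ScatteringConjSymmetryPairU`: THE REFLECTION PRINCIPLE FOR A PAIR — `f(conj z) = conj g(z)` ON THE TUBE ⟹ OFF THE POLE SET (the (hconj) letter for permuted matrix entries
# `qc_{ij}`, `qc_{π i π j}` of the scattering operator at a general level)

Track B ∕ K2-LIT, crux h413 = `stmt-HodgeConjecture-24833`; cell `hodgecm-mathlib`, squad K2, ENGINE E1, AMENDMENT #3 C.3 (hconj at level `K′ = K_∞·K_f(𝔫)`, `𝔫̄ = 𝔫`).  THEOREMS ONLY
(no `def`, no `instance`, no notation, no named-fact hypothesis, no `sorry`; default heartbeats); lane `--kind proof --supports stmt-HodgeConjecture-24833 --as helper` (count-neutral).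
Closes no socket.  PURE complex analysis (no automorphic object).

THE MATHEMATICS ([MoeglinWaldspurger1995, IV.1.10]; [Langlands1976, §7]; [Rudin1987, Thm. 11.14]).  At level `K_max` the scattering object of a self-dual `χ` is a scalar `s` and the
Galois twist gives `s(conj z) = conj s(z)` on the tube (★ `htube_of_godementScalar`), whence off the pole set (★ `apply_conj_eq_conj_apply_of_tube_of_poleSet`).  At a deeper
`c_G`-stable level the scattering object is a MATRIX `(qc_{ij})` in bases permuted (and conjugated) by `c_G`, and the tube identity couples TWO entries: `qc_{ij}(conj z) = conj
qc_{π i, π j}(z)`.  The continuation step is the same Schwarz-reflection ∕ identity-theorem argument, for a PAIR `(f, g)`: if `f`, `g` are holomorphic on an open preconnected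
conjugation-symmetric `U ⊇ {Re > 1}` and `f(conj z) = conj g(z)` for `Re z > 1`, then `u(z) := conj g(conj z)` is holomorphic on `U` (★ `differentiableOn_conj_comp_conj`) and agrees
with `f` on the open tube, hence on `U`; i.e. `f(conj z) = conj g(z)` for all `z ∈ U`.  With `U := (P ∪ conj⁻¹ P)ᶜ` for a closed co-discrete `P ⊆ {Re ≤ 1}` off which `f`, `g` are
analytic (★ X2_χ's clause shapes) this is the (hconj)-letter shape `∀ z, z ∉ P → conj z ∉ P → f (conj z) = conj (g z)`.
* §1 **`pair_apply_conj_eq_conj_apply_of_tube'`** (on `U`), **`pair_apply_conj_eq_conj_apply_of_tube_of_poleSet`** (the `(P, f, g)` packaging); the one-function ★ heads are the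
  diagonal case `f = g`.
HONEST LABEL: HC_CM is proved only modulo the 7 printed citations (2 remaining named inputs: hLiu418 = `stmt-HodgeConjecture-24832`, h413 = `stmt-HodgeConjecture-24833`) until rung 0
closes; this file asserts no named fact and closes no socket; count-neutral.

## References
* [MoeglinWaldspurger1995] C. Mœglin, J.-L. Waldspurger, *Spectral decomposition and Eisenstein series* (1995), IV.1.10.
* [Langlands1976] R. P. Langlands, *On the Functional Equations Satisfied by Eisenstein Series*, LNM 544 (1976), §7.
* [Rudin1987] W. Rudin, *Real and Complex Analysis* (3rd ed., 1987), Thm. 11.14 (Schwarz reflection principle).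
-/

set_option autoImplicit false
set_option linter.dupNamespace false  -- the mandated namespace repeats the summit's segment (`HodgeConjecture.HodgeConjecture`)

noncomputable section

open Set Filter Topology Complex
open scoped ComplexConjugate
open Summit.HodgeConjecture.HodgeConjecture.Cruxes.H413.K2E1MaassSelbergContinuedCMTwo (differentiableOn_conj_comp_conj)
open Summit.HodgeConjecture.HodgeConjecture.Cruxes.H413.K2E1ConvexDiffCountableConnected (countable_of_codiscrete isPreconnected_convex_diff_of_countable)

namespace Summit.HodgeConjecture.HodgeConjecture.Cruxes.H413.K2E1ScatteringConjSymmetryPairU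

/-! ## §1 The reflection principle for a pair `(f, g)` -/

/-- **`f(conj z) = conj g(z)` ON `U` FROM THE TUBE** (pair edition of ★ `apply_conj_eq_conj_apply_of_tube'`): `U ⊆ ℂ` open, preconnected, conjugation-symmetric, `⊇ {Re > 1}`; `f`, `g`
holomorphic on `U`; `f(conj z) = conj g(z)` for `1 < Re z`.  THEN the same holds on all of `U` (`z ↦ conj g(conj z)` is holomorphic on `U` and equals `f` on the open tube).
[cite: MoeglinWaldspurger1995, IV.1.10] [cite: Rudin1987, Thm. 11.14] -/
theorem pair_apply_conj_eq_conj_apply_of_tube' {U : Set ℂ} (hU : IsOpen U) (hUc : IsPreconnected U) (hUsym : ∀ z ∈ U, conj z ∈ U)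
    (hUtube : {z : ℂ | 1 < z.re} ⊆ U) {f g : ℂ → ℂ} (hf : DifferentiableOn ℂ f U) (hg : DifferentiableOn ℂ g U)
    (htube : ∀ z : ℂ, 1 < z.re → f (conj z) = conj (g z)) :
    ∀ z ∈ U, f (conj z) = conj (g z) := by
  -- the reflected function `u z := conj (g (conj z))`, holomorphic on `conj⁻¹U = U`
  have hpre : {w : ℂ | conj w ∈ U} = U := by
    ext w
    refine ⟨fun h => ?_, fun h => hUsym w h⟩
    have := hUsym _ h
    rwa [Complex.conj_conj] at this
  have hu : DifferentiableOn ℂ (fun z : ℂ => conj (g (conj z))) U := by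
    have h := differentiableOn_conj_comp_conj hU hg
    rwa [hpre] at h
  -- `u = f` on the open tube: `f w = f (conj (conj w)) = conj (g (conj w))` for `1 < Re (conj w) = Re w`
  have h2 : (2 : ℂ) ∈ U := hUtube (by simp)
  have hev : (fun z : ℂ => conj (g (conj z))) =ᶠ[𝓝 (2 : ℂ)] f := by
    have hopen : IsOpen {z : ℂ | 1 < z.re} := isOpen_lt continuous_const Complex.continuous_re
    filter_upwards [hopen.mem_nhds (show (2 : ℂ) ∈ {z : ℂ | 1 < z.re} by simp)] with z hz
    have hz' : 1 < (conj z).re := by rwa [Complex.conj_re]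
    have h := htube (conj z) hz'
    rw [Complex.conj_conj] at h
    exact h.symm
  -- identity theorem on the preconnected `U`
  have heq := (hu.analyticOnNhd hU).eqOn_of_preconnected_of_eventuallyEq (hf.analyticOnNhd hU) hUc h2 hev
  intro z hz
  have h := heq (hUsym z hz)
  simp only [Complex.conj_conj] at h
  exact h.symm

/-- **THE (hconj)-LETTER FOR A PAIR OF ENTRIES.**  `P` closed, co-discrete, `⊆ {Re ≤ 1}`; `f`, `g` analytic off `P` (★ X2_χ's (E3)∕(E4) clause shapes); the tube identity
`f(conj z) = conj g(z)` for `1 < Re z`.  THEN `f(conj z) = conj g(z)` whenever `z ∉ P`, `conj z ∉ P` — §1 on `V = (P ∪ conj⁻¹P)ᶜ` (open, preconnected as the complement of a countable set,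
conjugation-symmetric, `⊇ {Re > 1}`); the one-function ★ `apply_conj_eq_conj_apply_of_tube_of_poleSet` is the case `f = g`. [cite: MoeglinWaldspurger1995, IV.1.10] [cite: Langlands1976, §7] -/
theorem pair_apply_conj_eq_conj_apply_of_tube_of_poleSet {P : Set ℂ} {f g : ℂ → ℂ} (hPc : IsClosed P) (hPcd : ∀ z₀ : ℂ, ∀ᶠ s in 𝓝[≠] z₀, s ∉ P)
    (hPre : ∀ z ∈ P, z.re ≤ 1) (hfan : ∀ z : ℂ, z ∉ P → AnalyticAt ℂ f z) (hgan : ∀ z : ℂ, z ∉ P → AnalyticAt ℂ g z)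
    (htube : ∀ z : ℂ, 1 < z.re → f (conj z) = conj (g z)) :
    ∀ z : ℂ, z ∉ P → conj z ∉ P → f (conj z) = conj (g z) := by
  intro z hz hz'
  set V : Set ℂ := (P ∪ {w : ℂ | conj w ∈ P})ᶜ with hV
  have hVo : IsOpen V := (hPc.union (hPc.preimage continuous_conj)).isOpen_compl
  have hconjP : {w : ℂ | conj w ∈ P} = (starRingEnd ℂ) '' P := by
    ext w
    refine ⟨fun h => ⟨conj w, h, conj_conj w⟩, ?_⟩
    rintro ⟨u, hu, rfl⟩
    show conj (conj u) ∈ P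
    rwa [conj_conj]
  have hVcount : (P ∪ {w : ℂ | conj w ∈ P}).Countable := (countable_of_codiscrete hPcd).union (by rw [hconjP]; exact (countable_of_codiscrete hPcd).image _)
  have hVpre : IsPreconnected V := by
    have e : V = univ \ (P ∪ {w : ℂ | conj w ∈ P}) := by ext w; simp [hV]
    rw [e]
    exact isPreconnected_convex_diff_of_countable Literature.Topology.Euclidean.one_lt_rank_real_complex convex_univ isOpen_univ hVcount
  have hVsym : ∀ w ∈ V, conj w ∈ V := fun w hw h => hw (by
    rcases h with h | h
    · exact Or.inr h
    · rw [mem_setOf_eq, conj_conj] at h; exact Or.inl h)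
  have hVtube : {w : ℂ | 1 < w.re} ⊆ V := fun w hw h => by
    rcases h with h | h
    · have := hPre w h; simp only [mem_setOf_eq] at hw; linarith
    · have := hPre _ h; rw [conj_re] at this; simp only [mem_setOf_eq] at hw; linarith
  have hfV : DifferentiableOn ℂ f V := fun w hw => (hfan w fun h => hw (Or.inl h)).differentiableAt.differentiableWithinAt
  have hgV : DifferentiableOn ℂ g V := fun w hw => (hgan w fun h => hw (Or.inl h)).differentiableAt.differentiableWithinAt
  exact pair_apply_conj_eq_conj_apply_of_tube' hVo hVpre hVsym hVtube hfV hgV htube z (fun h => h.elim hz hz')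

/-- **SYMMETRY OF THE PAIR LETTER**: `f(conj z) = conj g(z)` off `P ∪ conj⁻¹P` ⟹ `g(conj z) = conj f(z)` off `P ∪ conj⁻¹P` (apply at `conj z` and conjugate). [folklore] -/
theorem pair_symm {P : Set ℂ} {f g : ℂ → ℂ} (h : ∀ z : ℂ, z ∉ P → conj z ∉ P → f (conj z) = conj (g z)) :
    ∀ z : ℂ, z ∉ P → conj z ∉ P → g (conj z) = conj (f z) := by
  intro z hz hz'
  have h1 := h (conj z) hz' (by rwa [Complex.conj_conj])
  rw [Complex.conj_conj] at h1
  rw [h1, Complex.conj_conj]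

end Summit.HodgeConjecture.HodgeConjecture.Cruxes.H413.K2E1ScatteringConjSymmetryPairU

end
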